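import Summits.AtomisticToContinuum.FouriersLaw.Theses.OddSectorIrreversibility
import Literature.MathematicalPhysics.KineticTheory.LangevinChainGibbs
import Literature.MathematicalPhysics.KineticTheory.LangevinChainFlowBounds
import Literature.MathematicalPhysics.KineticTheory.LangevinChainEnergyIdentity

/-!
# `ClosedConeSensitivity` / Negative (1/2): the zero-friction dictionary and time zero

Negative-side support for crux `stmt-AtomisticToContinuum-14059`
(`OddSectorIrreversibility.ClosedConeSensitivity`, "E3", rank 4), from the standing disprover's
work file `Cruxes/ClosedConeSensitivity/Disproof.lean` §0–§2, all sorry-free. Nothing here closes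
the item and no Theses statement is asserted positively. Companion: `Negative/TangentReduction.lean`.

* §1 DICTIONARY. The zero-friction transition kernel of the pinned chain is the Dirac mass at the
  deterministic Hamiltonian flow `detFlow` (`transitionKernel_zero_friction`; noise amplitude
  `√(2·0·T) = 0`), integrals against it are evaluations (`integral_transitionKernel_zero_friction`),
  `detFlow 0 = id`, `detFlow t` is continuous in the initial point, and the energy is conserved
  (`hamiltonian_detFlow`, from the pathwise energy identity); `H` and `j` do not depend on `γ`.
* §0 `closedConeSensitivity_iff_det`: E3 is LITERALLY the finite-difference statement
  `∃ a κ C, ConeBoundAt …` about the closed flow.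
* §2 time zero: `bondCurrent_kick_contact`, `bondCurrent_kick_far`, and the tightness consequence
  `contactForce_sq_le_of_closedConeSensitivity` (`4C·Z ≥ ∫V'(q₁−q₀)² e^{-H/T}` for all `N ≥ 2`):
  the `s²·Z` scaling of E3 is exact at `t = 0`, the statement is non-vacuous.
-/

noncomputable section

namespace Summit.AtomisticToContinuum.FouriersLaw.Theorems.ClosedConeSensitivity.Negative.ZeroFrictionDictionary

open MeasureTheory Filter Topology ProbabilityTheory
open scoped NNReal ENNReal
open Literature.MathematicalPhysics.KineticTheory.HeatConduction
open Literature.Probability.Process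
open Summit.AtomisticToContinuum.FouriersLaw.Theses.OddSectorIrreversibility

/-! ## §1 the closed flow behind the zero-friction kernels -/

/-- The deterministic (closed, isolated) Hamiltonian flow of the pinned chain: the pathwise
solution `chainFlow` of `LangevinChainSDE` driven by the ZERO noise path. [folklore] -/
def detFlow (ω₂ lam β : ℝ) (N : ℕ) (t : ℝ) (x : PhaseSpace N) : PhaseSpace N :=
  (pinnedChain ω₂ lam β 0).chainFlow N x (fun _ _ => 0) t

/-- At zero friction the noise amplitudes vanish and the noise path is identically zero. [folklore] -/
theorem chainNoise_zero_amp (N : ℕ) (w : WienerPair) : chainNoise N 0 0 w = fun _ _ => 0 := by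
  funext t i
  simp [chainNoise]

/-- The solution map of the zero-friction chain is the deterministic flow, for every driving pair. [folklore] -/
theorem solMap_zero_friction (ω₂ lam β : ℝ) (N : ℕ) (T_L T_R t : ℝ) (x : PhaseSpace N) (w : WienerPair) :
    (pinnedChain ω₂ lam β 0).solMap N T_L T_R t x w = detFlow ω₂ lam β N t x := by
  unfold OscillatorChain.solMap detFlow
  have hγ : (pinnedChain ω₂ lam β 0).γ = 0 := rfl
  rw [hγ]
  simp only [mul_zero, zero_mul, Real.sqrt_zero]
  rw [chainNoise_zero_amp]

variable {ω₂ lam β : ℝ} (hω : 0 < ω₂) (hl : 0 ≤ lam) (hβ : 0 ≤ β)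
include hω hl hβ

/-- **The zero-friction transition kernel is the Dirac mass at the deterministic flow.** [folklore] -/
theorem transitionKernel_zero_friction (N : ℕ) (T_L T_R : ℝ) (t : ℝ≥0) (x : PhaseSpace N) :
    (pinnedChain ω₂ lam β 0).transitionKernel N T_L T_R t x = Measure.dirac (detFlow ω₂ lam β N t x) := by
  rw [pinnedChain_transitionKernel_apply hω hl hβ le_rfl N T_L T_R t x]
  have h : (fun ω : WienerPair => (pinnedChain ω₂ lam β 0).solMap N T_L T_R t x (pairPath ω)) =
      fun _ => detFlow ω₂ lam β N t x := funext fun ω => solMap_zero_friction ω₂ lam β N T_L T_R t x _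
  rw [h, Measure.map_const, measure_univ, one_smul]

/-- Integrals against the zero-friction kernels are evaluations along the deterministic flow. [folklore] -/
theorem integral_transitionKernel_zero_friction (N : ℕ) (T_L T_R : ℝ) (t : ℝ≥0) (x : PhaseSpace N)
    (g : PhaseSpace N → ℝ) :
    ∫ y, g y ∂((pinnedChain ω₂ lam β 0).transitionKernel N T_L T_R t x) = g (detFlow ω₂ lam β N t x) := by
  rw [transitionKernel_zero_friction hω hl hβ, integral_dirac]

omit hω hl hβ in
/-- The deterministic flow at time `≤ 0` is the identity. [folklore] -/
theorem detFlow_of_nonpos (N : ℕ) {t : ℝ} (ht : t ≤ 0) (x : PhaseSpace N) : detFlow ω₂ lam β N t x = x := by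
  unfold detFlow
  rw [pinnedChain_chainFlow_of_nonpos ω₂ lam β 0 N x continuous_const ht]
  ext i <;> simp

/-- The deterministic flow is continuous in the initial condition. [folklore] -/
theorem continuous_detFlow (N : ℕ) (t : ℝ) : Continuous (detFlow ω₂ lam β N t) :=
  pinnedChain_continuous_chainFlow_left hω hl hβ le_rfl N continuous_const t

/-- **Energy conservation** along the deterministic flow (the pathwise energy identity with zero
noise and zero friction). [folklore] -/
theorem hamiltonian_detFlow (N : ℕ) {t : ℝ} (ht : 0 ≤ t) (x : PhaseSpace N) :
    (pinnedChain ω₂ lam β 0).hamiltonian N (detFlow ω₂ lam β N t x) = (pinnedChain ω₂ lam β 0).hamiltonian N x := by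
  unfold detFlow
  rw [pinnedChain_hamiltonian_chainFlow_eq hω hl hβ le_rfl N x continuous_const ht]
  have hγ : (pinnedChain ω₂ lam β 0).γ = 0 := rfl
  simp [OscillatorChain.noiseWork, OscillatorChain.dissipation, hγ]


omit hω hl hβ in
/-- The Hamiltonian does not depend on the friction constant. [folklore] -/
theorem hamiltonian_indep_friction (γ : ℝ) (N : ℕ) :
    (pinnedChain ω₂ lam β γ).hamiltonian N = (pinnedChain ω₂ lam β 0).hamiltonian N := rfl

omit hω hl hβ in
/-- The bond currents do not depend on the friction constant. [folklore] -/
theorem bondCurrent_indep_friction (γ : ℝ) (N : ℕ) :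
    (pinnedChain ω₂ lam β γ).bondCurrent N = (pinnedChain ω₂ lam β 0).bondCurrent N := rfl

/-! ## §0 the crux, verbatim, and read through the dictionary -/

omit hω hl hβ in
/-- The crux elaborates and has the displayed shape (refuter probe, rc 0). [folklore] -/
theorem probe_shape : ClosedConeSensitivity ↔
    ∀ ω₂ lam β γ : ℝ, 0 < ω₂ → 0 < lam → 0 < β → 0 < γ → ∀ T : ℝ, 0 < T → ∃ a κ C : ℝ, 0 < a ∧ 0 < κ ∧ ∀ (N : ℕ) (i b : Fin N) (t s : ℝ), (b.val = 0 ∨ b.val = N - 1) → 0 ≤ t → 0 < s → s ≤ 1 → let P := Literature.MathematicalPhysics.KineticTheory.HeatConduction.pinnedChain ω₂ lam β γ; let P₀ := Literature.MathematicalPhysics.KineticTheory.HeatConduction.pinnedChain ω₂ lam β 0; let μT : MeasureTheory.Measure (Literature.MathematicalPhysics.KineticTheory.HeatConduction.PhaseSpace N) := MeasureTheory.volume.withDensity (fun x : Literature.MathematicalPhysics.KineticTheory.HeatConduction.PhaseSpace N => ENNReal.ofReal (Real.exp (-(P.hamiltonian N x) / T))); let d : ℕ := (if b.val = 0 then i.val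 else N - 2 - i.val); t ≤ a * (d : ℝ) → ∫ x, ((∫ y, P.bondCurrent N i y ∂(P₀.transitionKernel N T T t.toNNReal (x.1, Function.update x.2 b (x.2 b + s)))) - (∫ y, P.bondCurrent N i y ∂(P₀.transitionKernel N T T t.toNNReal x))) ^ 2 ∂μT ≤ C * s ^ 2 * Real.exp (-(κ * ((d : ℝ) - t / a))) * ∫ x, Real.exp (-(P.hamiltonian N x) / T) ∂MeasureTheory.volume :=
  Iff.rfl

/-- The body of `E3` at fixed parameters and constants `(a, κ, C)`, read through the dictionary of
§1: the kernel integrals are evaluations along the closed deterministic flow `detFlow`, so the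
left-hand side is the Gibbs mean square of a FINITE DIFFERENCE of `j_i ∘ Φ_t` under a momentum kick
of size `s` at the contact `b`. [folklore] -/
def ConeBoundAt (ω₂ lam β γ T a κ C : ℝ) : Prop :=
    ∀ (N : ℕ) (i b : Fin N) (t s : ℝ), (b.val = 0 ∨ b.val = N - 1) → 0 ≤ t → 0 < s → s ≤ 1 →
      let P := pinnedChain ω₂ lam β γ
      let μT : Measure (PhaseSpace N) :=
        volume.withDensity (fun x => ENNReal.ofReal (Real.exp (-(P.hamiltonian N x) / T)))
      let d : ℕ := (if b.val = 0 then i.val else N - 2 - i.val)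
      t ≤ a * (d : ℝ) →
        ∫ x, (P.bondCurrent N i (detFlow ω₂ lam β N t (x.1, Function.update x.2 b (x.2 b + s))) -
              P.bondCurrent N i (detFlow ω₂ lam β N t x)) ^ 2 ∂μT
          ≤ C * s ^ 2 * Real.exp (-(κ * ((d : ℝ) - t / a))) * ∫ x, Real.exp (-(P.hamiltonian N x) / T) ∂volume

omit hω hl hβ in
/-- **Dictionary.** `E3` is literally the finite-difference statement about the closed flow. [folklore] -/
theorem closedConeSensitivity_iff_det : ClosedConeSensitivity ↔
    ∀ ω₂ lam β γ : ℝ, 0 < ω₂ → 0 < lam → 0 < β → 0 < γ → ∀ T : ℝ, 0 < T →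
      ∃ a κ C : ℝ, 0 < a ∧ 0 < κ ∧ ConeBoundAt ω₂ lam β γ T a κ C := by
  unfold ClosedConeSensitivity ConeBoundAt
  constructor
  · intro h ω₂ lam β γ hω hl hβ hγ T hT
    obtain ⟨a, κ, C, ha, hκ, H⟩ := h ω₂ lam β γ hω hl hβ hγ T hT
    refine ⟨a, κ, C, ha, hκ, fun N i b t s hb ht hs hs1 => ?_⟩
    have H' := H N i b t s hb ht hs hs1
    simp only [integral_transitionKernel_zero_friction hω hl.le hβ.le, Real.coe_toNNReal _ ht] at H' ⊢
    exact H'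
  · intro h ω₂ lam β γ hω hl hβ hγ T hT
    obtain ⟨a, κ, C, ha, hκ, H⟩ := h ω₂ lam β γ hω hl hβ hγ T hT
    refine ⟨a, κ, C, ha, hκ, fun N i b t s hb ht hs hs1 => ?_⟩
    have H' := H N i b t s hb ht hs hs1
    simp only [integral_transitionKernel_zero_friction hω hl.le hβ.le, Real.coe_toNNReal _ ht] at H' ⊢
    exact H'

/-! ## §2 time zero: the statement is non-vacuous and its `s² · Z` scaling is exact there -/

omit hω hl hβ in
/-- At `t = 0` the integrand of `E3` is the static finite difference of the current. [folklore] -/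
theorem integrand_time_zero (γ : ℝ) (N : ℕ) (i b : Fin N) (s : ℝ) (x : PhaseSpace N) :
    (pinnedChain ω₂ lam β γ).bondCurrent N i (detFlow ω₂ lam β N 0 (x.1, Function.update x.2 b (x.2 b + s))) -
      (pinnedChain ω₂ lam β γ).bondCurrent N i (detFlow ω₂ lam β N 0 x)
    = (pinnedChain ω₂ lam β γ).bondCurrent N i (x.1, Function.update x.2 b (x.2 b + s)) -
      (pinnedChain ω₂ lam β γ).bondCurrent N i x := by
  rw [detFlow_of_nonpos N le_rfl, detFlow_of_nonpos N le_rfl]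

omit hω hl hβ in
/-- Kicking the contact momentum `p_0` by `s` changes the contact current `j_0` by
`-(s/2) V'(q_1 - q_0)` (and nothing else enters at `t = 0`). [folklore] -/
theorem bondCurrent_kick_contact (γ : ℝ) {N : ℕ} (h2 : 2 ≤ N) (x : PhaseSpace N) (s : ℝ) :
    (pinnedChain ω₂ lam β γ).bondCurrent N ⟨0, by omega⟩
        (x.1, Function.update x.2 ⟨0, by omega⟩ (x.2 ⟨0, by omega⟩ + s)) -
      (pinnedChain ω₂ lam β γ).bondCurrent N ⟨0, by omega⟩ x
    = -(s / 2 * deriv (pinnedChain ω₂ lam β γ).V (x.1 ⟨1, by omega⟩ - x.1 ⟨0, by omega⟩)) := by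
  unfold OscillatorChain.bondCurrent
  rw [← Finset.sum_sub_distrib, Finset.sum_eq_single ⟨1, by omega⟩]
  · have h10 : (⟨1, by omega⟩ : Fin N) ≠ ⟨0, by omega⟩ := by simp [Fin.ext_iff]
    simp only [zero_add, ↓reduceIte, Function.update_self, Function.update_of_ne h10]
    ring
  · intro j _ hj
    have : ¬ (j.val = 0 + 1) := fun h => hj (Fin.ext (by simpa using h))
    simp [this]
  · intro h; exact absurd (Finset.mem_univ _) h

omit hω hl hβ in
/-- A kick at `p_b` is invisible at time `0` to every bond not containing the site `b`. [folklore] -/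
theorem bondCurrent_kick_far (γ : ℝ) {N : ℕ} (i b : Fin N) (hb : b.val ≠ i.val) (hb' : b.val ≠ i.val + 1)
    (x : PhaseSpace N) (s : ℝ) :
    (pinnedChain ω₂ lam β γ).bondCurrent N i (x.1, Function.update x.2 b (x.2 b + s)) =
      (pinnedChain ω₂ lam β γ).bondCurrent N i x := by
  unfold OscillatorChain.bondCurrent
  refine Finset.sum_congr rfl fun j _ => ?_
  by_cases hj : j.val = i.val + 1
  · have hjb : j ≠ b := fun h => hb' (by rw [← h]; exact hj)
    have hib : i ≠ b := fun h => hb (by rw [h])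
    simp only [hj, ↓reduceIte, Function.update_of_ne hib, Function.update_of_ne hjb]
  · simp [hj]

omit hl hβ in
/-- **Tightness at `t = 0` / what `C` must dominate.** Any constant `C` admissible in `E3`
bounds the `N`-uniform Gibbs second moment of the contact force:
`∫ V'(q_1 - q_0)² e^{-H/T} ≤ 4 C · Z_N` for every `N ≥ 2` (take `i = b = 0`, `t = 0`, `s = 1`).
So the `s²·Z` scaling of the right-hand side is exact at `t = 0` and `E3` is not vacuous. [folklore] -/
theorem contactForce_sq_le_of_closedConeSensitivity (hE3 : ClosedConeSensitivity) {γ : ℝ} (hγ : 0 < γ)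
    (hl' : 0 < lam) (hβ' : 0 < β) {T : ℝ} (hT : 0 < T) :
    ∃ C : ℝ, ∀ (N : ℕ) (h2 : 2 ≤ N),
      ∫ x, (deriv (pinnedChain ω₂ lam β γ).V (x.1 ⟨1, by omega⟩ - x.1 ⟨0, by omega⟩)) ^ 2
          ∂(volume.withDensity (fun x : PhaseSpace N =>
              ENNReal.ofReal (Real.exp (-((pinnedChain ω₂ lam β γ).hamiltonian N x) / T))))
        ≤ 4 * C * ∫ x : PhaseSpace N, Real.exp (-((pinnedChain ω₂ lam β γ).hamiltonian N x) / T) ∂volume := by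
  obtain ⟨a, κ, C, ha, hκ, H⟩ := (closedConeSensitivity_iff_det.mp hE3) ω₂ lam β γ hω hl' hβ' hγ T hT
  unfold ConeBoundAt at H
  refine ⟨C, fun N h2 => ?_⟩
  have H0 := H N ⟨0, by omega⟩ ⟨0, by omega⟩ 0 1 (Or.inl rfl) le_rfl one_pos le_rfl
  simp only [↓reduceIte, CharP.cast_eq_zero, mul_zero, le_refl, zero_div, sub_zero, neg_zero,
    Real.exp_zero, mul_one, one_pow, forall_const] at H0
  have key : ∀ x : PhaseSpace N,
      ((pinnedChain ω₂ lam β γ).bondCurrent N ⟨0, by omega⟩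
          (detFlow ω₂ lam β N 0 (x.1, Function.update x.2 ⟨0, by omega⟩ (x.2 ⟨0, by omega⟩ + 1))) -
        (pinnedChain ω₂ lam β γ).bondCurrent N ⟨0, by omega⟩ (detFlow ω₂ lam β N 0 x)) ^ 2 =
      (1 / 4) * (deriv (pinnedChain ω₂ lam β γ).V (x.1 ⟨1, by omega⟩ - x.1 ⟨0, by omega⟩)) ^ 2 := by
    intro x
    rw [integrand_time_zero, bondCurrent_kick_contact γ h2 x 1]
    ring
  simp only [key, integral_const_mul] at H0
  linarith


end Summit.AtomisticToContinuum.FouriersLaw.Theorems.ClosedConeSensitivity.Negative.ZeroFrictionDictionary
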